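import Summits.MatrixMultiplication.MatrixMultiplication.Theorems.AbelianSTPPCensusShapeCertSemantics

/-!
# Abelian STPP census — soundness of the `ShapeCert` checker for crux `ShapeExclusionTE` (part 2: budgets)

Cell mm-stpp, rung F-M1, route `AbelianSTPPCensus`; implementation B (seat eng-2).  The checker is defined in
`…Theorems.AbelianSTPPCensusShapeCertDefs`; the files `…ShapeCertSemantics` (shape arithmetic, the hereditary
sieve system `AdmM` on multisets of shapes, heredity), `…ShapeCertBudgets` (prefix aggregates versus the tail of
an admissible family), `…ShapeCertUniverse` (volume buckets, the decorated candidate list, completeness of the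
universe) and `…ShapeCertSearch` (the continuation bound, completeness of the admissibility test, the search
induction, `check_sound`) prove: `check M = true` ⇒ every `AdmM`-admissible shape multiset inside the universe
with integer gain `> 10⁶·M` contains a registered residual sub-multiset.
-/

set_option linter.dupNamespace false -- `MatrixMultiplication.MatrixMultiplication` (summit = problem, D-0017)
set_option autoImplicit false


namespace Summit.MatrixMultiplication.MatrixMultiplication.Theorems.ShapeCert

open Multiset

section aggregates
/-! ### List aggregates are multiset sums -/
variable {M : ℕ} {fam : List Sh}

/-- the shape multiset of an extended prefix -/
theorem famT_cons (t : Sh) (fam : List Sh) : famT (t :: fam) = t.tr ::ₘ famT fam := rfl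

/-- members of the prefix are in its shape multiset -/
theorem tr_mem_famT {t : Sh} (ht : t ∈ fam) : t.tr ∈ famT fam := by
  unfold famT; rw [Multiset.mem_coe]; exact List.mem_map.mpr ⟨t, ht, rfl⟩

/-- elements of the shape multiset come from members -/
theorem mem_famT {x : ℕ × ℕ × ℕ} (hx : x ∈ famT fam) : ∃ t ∈ fam, t.tr = x := by
  unfold famT at hx; rw [Multiset.mem_coe] at hx; exact List.mem_map.mp hx

/-- first component of `tr` -/
theorem tr_fst (t : Sh) : t.tr.1 = t.a := rfl
/-- second component of `tr` -/
theorem tr_snd (t : Sh) : t.tr.2.1 = t.b := rfl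
/-- third component of `tr` -/
theorem tr_thd (t : Sh) : t.tr.2.2 = t.c := rfl

/-- a list aggregate of a well-formed prefix is the multiset sum of the matching triple function -/
theorem agg_sum_eq (hw : WfL M fam) (f : Sh → ℕ) (g : ℕ × ℕ × ℕ → ℕ) (hfg : ∀ x, f (shOf M x) = g x) :
    (fam.map f).sum = ((famT fam).map g).sum := by
  unfold famT
  rw [Multiset.map_coe, Multiset.sum_coe, List.map_map]
  congr 1
  apply List.map_congr_left
  intro t ht
  simp only [Function.comp_apply]
  rw [← hfg t.tr, ← hw t ht]

/-- `gs` as a multiset sum -/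
theorem gs_eq (hw : WfL M fam) : gs fam = gsumM (famT fam) := agg_sum_eq hw _ _ (shOf_g M)
/-- `sA` as a multiset sum -/
theorem sA_eq (hw : WfL M fam) : sA fam = ((famT fam).map wa).sum := agg_sum_eq hw _ _ (shOf_wA M)
/-- `sB` as a multiset sum -/
theorem sB_eq (hw : WfL M fam) : sB fam = ((famT fam).map wb).sum := agg_sum_eq hw _ _ (shOf_wB M)
/-- `sC` as a multiset sum -/
theorem sC_eq (hw : WfL M fam) : sC fam = ((famT fam).map wc).sum := agg_sum_eq hw _ _ (shOf_wC M)
/-- `sab` as a multiset sum -/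
theorem sab_eq (hw : WfL M fam) : sab fam = ((famT fam).map pab).sum := agg_sum_eq hw _ _ (shOf_ab M)
/-- `sbc` as a multiset sum -/
theorem sbc_eq (hw : WfL M fam) : sbc fam = ((famT fam).map pbc).sum := agg_sum_eq hw _ _ (shOf_bc M)
/-- `sca` as a multiset sum -/
theorem sca_eq (hw : WfL M fam) : sca fam = ((famT fam).map pca).sum := agg_sum_eq hw _ _ (shOf_ca M)

/-- bounding `dAB` -/
theorem dAB_le {n : ℕ} (h : ∀ t ∈ fam, t.dab ≤ n) : dAB fam ≤ n :=
  foldr_max_le fun y hy => by obtain ⟨t, ht, rfl⟩ := List.mem_map.mp hy; exact h t ht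
/-- bounding `dBC` -/
theorem dBC_le {n : ℕ} (h : ∀ t ∈ fam, t.dbc ≤ n) : dBC fam ≤ n :=
  foldr_max_le fun y hy => by obtain ⟨t, ht, rfl⟩ := List.mem_map.mp hy; exact h t ht
/-- bounding `dCA` -/
theorem dCA_le {n : ℕ} (h : ∀ t ∈ fam, t.dca ≤ n) : dCA fam ≤ n :=
  foldr_max_le fun y hy => by obtain ⟨t, ht, rfl⟩ := List.mem_map.mp hy; exact h t ht
/-- bounding `mxP` -/
theorem mxP_le {n : ℕ} (h : ∀ t ∈ fam, t.mpp ≤ n) : mxP fam ≤ n :=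
  foldr_max_le fun y hy => by obtain ⟨t, ht, rfl⟩ := List.mem_map.mp hy; exact h t ht
/-- bounding `mxV` -/
theorem mxV_le {n : ℕ} (h : ∀ t ∈ fam, t.V ≤ n) : mxV fam ≤ n :=
  foldr_max_le fun y hy => by obtain ⟨t, ht, rfl⟩ := List.mem_map.mp hy; exact h t ht
/-- bounding by `M + mnA` -/
theorem le_add_mnA {X M : ℕ} (h0 : X ≤ M + M) (h : ∀ t ∈ fam, X ≤ M + t.a) : X ≤ M + mnA fam M :=
  le_add_foldr_min h0 fun y hy => by obtain ⟨t, ht, rfl⟩ := List.mem_map.mp hy; exact h t ht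
/-- bounding by `M + mnB` -/
theorem le_add_mnB {X M : ℕ} (h0 : X ≤ M + M) (h : ∀ t ∈ fam, X ≤ M + t.b) : X ≤ M + mnB fam M :=
  le_add_foldr_min h0 fun y hy => by obtain ⟨t, ht, rfl⟩ := List.mem_map.mp hy; exact h t ht
/-- bounding by `M + mnC` -/
theorem le_add_mnC {X M : ℕ} (h0 : X ≤ M + M) (h : ∀ t ∈ fam, X ≤ M + t.c) : X ≤ M + mnC fam M :=
  le_add_foldr_min h0 fun y hy => by obtain ⟨t, ht, rfl⟩ := List.mem_map.mp hy; exact h t ht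

end aggregates

section budgets
/-! ### The tail of an admissible family above a prefix -/

variable {M : ℕ} {G : Multiset (ℕ × ℕ × ℕ)} {fam : List Sh}

/-- Standing hypotheses: an admissible family `G` inside the universe, above the well-formed prefix `fam`. -/
structure Above (M : ℕ) (G : Multiset (ℕ × ℕ × ℕ)) (fam : List Sh) : Prop where
  univ : ∀ x ∈ G, InUniv M x
  adm : AdmM M G
  wf : WfL M fam
  le : famT fam ≤ G

/-- prefix members belong to the family -/
theorem Above.mem_G (h : Above M G fam) {t : Sh} (ht : t ∈ fam) : t.tr ∈ G :=
  Multiset.mem_of_le h.le (tr_mem_famT ht)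

/-- tail members belong to the family -/
theorem mem_G_of_tail {x : ℕ × ℕ × ℕ} (hx : x ∈ G - famT fam) : x ∈ G :=
  Multiset.mem_of_le (Multiset.sub_le_self _ _) hx

/-- U11: the tail's `Σ a(b+c)` fits the prefix's budget -/
theorem Above.tail_wa (h : Above M G fam) : ((G - famT fam).map wa).sum + sA fam ≤ M + mnA fam M := by
  have hs := sum_map_split h.le wa
  rw [sA_eq h.wf, add_comm, ← hs]
  apply le_add_mnA
  · rcases Multiset.empty_or_exists_mem G with hG | ⟨x, hx⟩
    · subst hG; simp
    · exact (h.adm.2.1 x hx).1.trans (by have := (h.univ x hx).a_le; omega)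
  · intro t ht; have := (h.adm.2.1 t.tr (h.mem_G ht)).1; rwa [tr_fst] at this

/-- U11: the tail's `Σ b(c+a)` fits the prefix's budget -/
theorem Above.tail_wb (h : Above M G fam) : ((G - famT fam).map wb).sum + sB fam ≤ M + mnB fam M := by
  have hs := sum_map_split h.le wb
  rw [sB_eq h.wf, add_comm, ← hs]
  apply le_add_mnB
  · rcases Multiset.empty_or_exists_mem G with hG | ⟨x, hx⟩
    · subst hG; simp
    · exact (h.adm.2.1 x hx).2.1.trans (by have := (h.univ x hx).b_le; omega)
  · intro t ht; have := (h.adm.2.1 t.tr (h.mem_G ht)).2.1; rwa [tr_snd] at this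

/-- U11: the tail's `Σ c(a+b)` fits the prefix's budget -/
theorem Above.tail_wc (h : Above M G fam) : ((G - famT fam).map wc).sum + sC fam ≤ M + mnC fam M := by
  have hs := sum_map_split h.le wc
  rw [sC_eq h.wf, add_comm, ← hs]
  apply le_add_mnC
  · rcases Multiset.empty_or_exists_mem G with hG | ⟨x, hx⟩
    · subst hG; simp
    · exact (h.adm.2.1 x hx).2.2.trans (by have := (h.univ x hx).c_le; omega)
  · intro t ht; have := (h.adm.2.1 t.tr (h.mem_G ht)).2.2; rwa [tr_thd] at this

/-- the erased-sum decomposition at a prefix member -/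
theorem Above.erase_split (h : Above M G fam) {t : Sh} (ht : t ∈ fam) (f : ℕ × ℕ × ℕ → ℕ) :
    ((G.erase t.tr).map f).sum + f t.tr = ((famT fam).map f).sum + ((G - famT fam).map f).sum := by
  have hmem := tr_mem_famT (fam := fam) ht
  have hG : G = famT fam + (G - famT fam) := by rw [add_comm, Multiset.sub_add_cancel h.le]
  have h1 : G.erase t.tr = (famT fam).erase t.tr + (G - famT fam) := by
    conv_lhs => rw [hG]
    exact Multiset.erase_add_left_pos _ hmem
  have h2 : ((famT fam).map f).sum = f t.tr + (((famT fam).erase t.tr).map f).sum := by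
    conv_lhs => rw [← Multiset.cons_erase hmem]
    simp
  rw [h1, h2]; simp; ring

/-- U14 (`ab`): the tail's `Σ ab` fits under the prefix's largest offset -/
theorem Above.tail_pab (h : Above M G fam) : ((G - famT fam).map pab).sum + dAB fam + sab fam ≤ M := by
  have hs := sum_map_split h.le pab
  have h2 : (G.map pab).sum ≤ M := h.adm.1.1
  rw [sab_eq h.wf]
  have key : ∀ t ∈ fam, t.dab + ((famT fam).map pab).sum + ((G - famT fam).map pab).sum ≤ M := by
    intro t ht
    have hx := h.mem_G ht
    obtain ⟨⟨a1, a2⟩, -, -⟩ := h.adm.2.2.2.1 t.tr hx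
    have hsp := h.erase_split ht pab
    have hpv := (h.univ _ hx).pab_le_vol
    rw [h.wf t ht, shOf_dab]
    by_cases hl : hasLCD (vol t.tr) M t.tr.2.2 = true
    · rw [if_pos hl]; omega
    · rw [if_neg hl]
      have : vol t.tr + ((G.erase t.tr).map pab).sum ≠ M := fun he => hl (a2 he)
      omega
  have hd : dAB fam ≤ M - (((famT fam).map pab).sum + ((G - famT fam).map pab).sum) :=
    dAB_le fun t ht => by have := key t ht; omega
  omega

/-- U14 (`bc`): the tail's `Σ bc` fits under the prefix's largest offset -/
theorem Above.tail_pbc (h : Above M G fam) : ((G - famT fam).map pbc).sum + dBC fam + sbc fam ≤ M := by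
  have hs := sum_map_split h.le pbc
  have h2 : (G.map pbc).sum ≤ M := h.adm.1.2.1
  rw [sbc_eq h.wf]
  have key : ∀ t ∈ fam, t.dbc + ((famT fam).map pbc).sum + ((G - famT fam).map pbc).sum ≤ M := by
    intro t ht
    have hx := h.mem_G ht
    obtain ⟨-, ⟨b1, b2⟩, -⟩ := h.adm.2.2.2.1 t.tr hx
    have hsp := h.erase_split ht pbc
    have hpv := (h.univ _ hx).pbc_le_vol
    rw [h.wf t ht, shOf_dbc]
    by_cases hl : hasLCD (vol t.tr) M t.tr.1 = true
    · rw [if_pos hl]; omega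
    · rw [if_neg hl]
      have : vol t.tr + ((G.erase t.tr).map pbc).sum ≠ M := fun he => hl (b2 he)
      omega
  have hd : dBC fam ≤ M - (((famT fam).map pbc).sum + ((G - famT fam).map pbc).sum) :=
    dBC_le fun t ht => by have := key t ht; omega
  omega

/-- U14 (`ca`): the tail's `Σ ca` fits under the prefix's largest offset -/
theorem Above.tail_pca (h : Above M G fam) : ((G - famT fam).map pca).sum + dCA fam + sca fam ≤ M := by
  have hs := sum_map_split h.le pca
  have h2 : (G.map pca).sum ≤ M := h.adm.1.2.2
  rw [sca_eq h.wf]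
  have key : ∀ t ∈ fam, t.dca + ((famT fam).map pca).sum + ((G - famT fam).map pca).sum ≤ M := by
    intro t ht
    have hx := h.mem_G ht
    obtain ⟨-, -, ⟨c1, c2⟩⟩ := h.adm.2.2.2.1 t.tr hx
    have hsp := h.erase_split ht pca
    have hpv := (h.univ _ hx).pca_le_vol
    rw [h.wf t ht, shOf_dca]
    by_cases hl : hasLCD (vol t.tr) M t.tr.2.1 = true
    · rw [if_pos hl]; omega
    · rw [if_neg hl]
      have : vol t.tr + ((G.erase t.tr).map pca).sum ≠ M := fun he => hl (c2 he)
      omega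
  have hd : dCA fam ≤ M - (((famT fam).map pca).sum + ((G - famT fam).map pca).sum) :=
    dCA_le fun t ht => by have := key t ht; omega
  omega

/-- volume cap: a tail member leaves room for the prefix's pair-product sums and largest pair product -/
theorem Above.tail_vol (h : Above M G fam) {x : ℕ × ℕ × ℕ} (hx : x ∈ G - famT fam) :
    vol x + sab fam ≤ M ∧ vol x + sbc fam ≤ M ∧ vol x + sca fam ≤ M ∧ vol x + mxP fam ≤ M := by
  have hxG := mem_G_of_tail hx
  have hle := le_erase_of_mem_sub h.le hx
  obtain ⟨⟨a1, -⟩, ⟨b1, -⟩, ⟨c1, -⟩⟩ := h.adm.2.2.2.1 x hxG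
  have e1 := sum_map_le_of_le hle pab
  have e2 := sum_map_le_of_le hle pbc
  have e3 := sum_map_le_of_le hle pca
  rw [← sab_eq h.wf] at e1; rw [← sbc_eq h.wf] at e2; rw [← sca_eq h.wf] at e3
  have hv : vol x ≤ M := by have := (h.univ x hxG).vol_le; omega
  have e4 : mxP fam ≤ M - vol x := mxP_le fun t ht => by
    have h9 := h.adm.2.2.1 t.tr (h.mem_G ht) x (mem_erase_of_mem_sub h.le hx (tr_mem_famT ht))
    have hm := congrArg Sh.mpp (h.wf t ht); rw [shOf_mpp] at hm
    omega
  omega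

/-- a dead prefix has no tail -/
theorem Above.tail_eq_zero_of_dead (h : Above M G fam) (hd : (aggOf M fam).dead M = true) :
    G - famT fam = 0 := by
  rcases Multiset.empty_or_exists_mem (G - famT fam) with h0 | ⟨x, hx⟩
  · exact h0
  exfalso
  have hxG := mem_G_of_tail hx
  have hU := h.univ x hxG
  have w1 := Multiset.le_sum_of_mem (Multiset.mem_map_of_mem wa hx)
  have w2 := Multiset.le_sum_of_mem (Multiset.mem_map_of_mem wb hx)
  have w3 := Multiset.le_sum_of_mem (Multiset.mem_map_of_mem wc hx)
  have t1 := h.tail_wa; have t2 := h.tail_wb; have t3 := h.tail_wc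
  obtain ⟨v1, v2, v3, v4⟩ := h.tail_vol hx
  have := hU.two_le_wa; have := hU.two_le_wb; have := hU.two_le_wc; have := hU.one_le_vol
  unfold Agg.dead Agg.ra Agg.rb Agg.rc Agg.vl Agg.mc aggOf at hd
  simp only [decide_eq_true_eq] at hd
  rcases hd with hd | hd | hd | hd
  · omega
  · omega
  · omega
  · have hm : max (max (sab fam) (max (sbc fam) (sca fam))) (mxP fam) ≤ M - vol x :=
      max_le (max_le (by omega) (max_le (by omega) (by omega))) (by omega)
    omega

end budgets

end Summit.MatrixMultiplication.MatrixMultiplication.Theorems.ShapeCert
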